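/-
Origin: expansion seat `planner-pub-hodgecm-pv09-g5-0`, handover #4 2026-08-18T09:28:42Z (`HOME/pub-hodgecm-pv09-g5/lean/Pv09g5/GenuineThetaInput.lean`, md5 8659cd30, 158 lines);
landed by the gen-7 packager in gate run 27 as `HodgeCM/PerL34/GenuineThetaInput.lean` (import ^import Pv[0-9]+g[0-9]+\.→import HodgeCM.PerL34. ×1).
-/
/-
Copyright: HodgeCM publication cell (pub-hodgecm), DAG node N31 (seam S3, PerL v5 Lemma 4.2(b)) — the representation-
theoretic INPUT of the genuine-torus S3 headline as ONE named structure.  Prover seat pub-hodgecm-pv09-g5 (DAG-node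
prover #09, generation 5), file #4 (HANDOVER #4).  Released under the package licence.

WIP import: `Pv09g5.GenuineHeadlineBase` ↦ `HodgeCM.PerL34.GenuineHeadlineBase` (this seat, HANDOVER #3).  Complete
proofs, no new axioms, nothing cited.
-/
import Summits.HodgeConjecture.HodgeCM.PerL34.GenuineHeadlineBase

/-!
# The input of Lemma 4.2(b) for `U(1)_{L/L⁺}`, by name

`GenuineHeadlineBase` (#3) proves the S3 headline for the genuine unitary torus of a CM field `L` from sixteen
representation-side binders typed over the base completions `L⁺_v` (tex ll. 600–616: the local unitary characters
`ν_v`, the spherical intertwiner off `S`, the ball model at the split places of `S`, isotypy at the non-split places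
of `S`).  This file packages exactly those binders as ONE structure
`PureTensor.GenuineThetaInput L S Sp ω φ χ` — DATA, not a proposition: an instance is what a construction of the
adelic theta model `(ω, φ, χ)` restricted to the torus must deliver — and restates the headline from it
(`exists_compactDomain_thetaLift_ne_zero_genuine_of_input`).  The S3 row of the node ledger can thus name its one
open input.  Nothing is posited: the structure is a `Type`-valued bundle of hypotheses of a theorem, never assumed
inhabited anywhere in the package.

Nothing is cited; PerL v5 ll. 600–640 is the USE of this statement.
-/

set_option autoImplicit false

noncomputable section

open MeasureTheory MeasureTheory.Measure Set Metric Function Complex ComplexConjugate Topology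
open scoped RestrictedProduct InnerProductSpace NNReal ENNReal

namespace HodgeCM.PerL34.PureTensor

open HodgeCM.PerL34.SplitShells HodgeCM.PerL34.AdelicFactorisation HodgeCM.PerL34.RestrictedMeasure
open HodgeCM.PerL34.NoSmallSubgroups HodgeCM.PerL34.EulerFactorisation HodgeCM.PerL34.DiscreteFD
open HodgeCM.PerL34.LocalFactors HodgeCM.PerL34.LocalFactors.DilationModel
open HodgeCM.PerL34.LocalModulus HodgeCM.PerL34.SplitPlaceDilation
open HodgeCM.PerL34.RallisIP HodgeCM.PerL34.Doubling HodgeCM.PerL34.N31d NumberField IsDedekindDomain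
open HodgeCM.PerL34.IdelePlaces HodgeCM.PerL34.RestrictedRegroup HodgeCM.PerL34.RestrictedCutout
open HodgeCM.PerL34.IdelicTorusModel HodgeCM.PerL34.IdelicTorusModel.Genuine

attribute [local instance] LocalFactors.DilationModel.Adic.nontriviallyNormedField
  LocalFactors.DilationModel.Adic.properSpace

/-! ## §1  The input structure -/

/-- **The representation-theoretic input of PerL v5 Lemma 4.2(b) for the genuine torus `U(1)_{L/L⁺}`**, relative
to a finite set of places `S` of `L⁺`, a unitary representation `ω` of the model group `Model L ≅ U(1)(𝔸_{L⁺})` on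
`Sp`, a vector `φ` and a character `χ` (tex ll. 600–616; split local groups read in `(L⁺_v)ˣ` through
`Genuine.baseTriv`, tex l. 610 `L_{0,v}^×`, `L_0 = L ∩ ℝ = L⁺`).  Sixteen fields = the sixteen representation-side binders of
`exists_compactDomain_thetaLift_ne_zero_genuine_base`, verbatim with `D.ω ↦ ω`. -/
structure GenuineThetaInput (L : Type) [Field L] [NumberField L] [IsCMField L]
    [DecidableEq (Place (maximalRealSubfield L))]
    [∀ v : HeightOneSpectrum (𝓞 (maximalRealSubfield L)), MeasurableSpace (v.adicCompletion (maximalRealSubfield L))]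
    [∀ v : HeightOneSpectrum (𝓞 (maximalRealSubfield L)), BorelSpace (v.adicCompletion (maximalRealSubfield L))]
    (S : Finset (Place (maximalRealSubfield L)))
    (Sp : Type) [NormedAddCommGroup Sp] [InnerProductSpace ℂ Sp]
    (ω : Model L →* (Sp ≃ₗᵢ[ℂ] Sp)) (φ : Sp) (χ : Model L →* Circle) where
  -- the local unitary characters `ν_v` of `(L⁺_v)ˣ`, unramified off `S`
  ν : ∀ i : Place (maximalRealSubfield L),
    ((basePlaceOf L i).adicCompletion (maximalRealSubfield L))ˣ →* Circle
  hν : ∀ i, i ∉ S → IsSplitPlace L i → ∀ u : ((basePlaceOf L i).adicCompletion (maximalRealSubfield L))ˣ,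
    ‖(u : (basePlaceOf L i).adicCompletion (maximalRealSubfield L))‖ = 1 → ν i u = 1
  -- split `v ∉ S`: the INTERTWINER on `1_{𝒪_v³}` along the base chart `baseTriv`
  VU : ∀ i, i ∉ S → IsSplitPlace L i →
    (Lp ℂ 2 (Adic.muV (maximalRealSubfield L) (basePlaceOf L i)) →ₗᵢ[ℂ] Sp)
  hVUψ : ∀ i (hi : i ∉ S) (hs : IsSplitPlace L i),
    VU i hi hs (ballIndicator (Adic.muV (maximalRealSubfield L) (basePlaceOf L i)) 0 1) = φ
  hVU : ∀ i (hi : i ∉ S) (hs : IsSplitPlace L i), ∀ g : locTorus (maximalRealSubfield L) L i,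
    ω (RestrictedProduct.mulSingle (genLevel L) i g)
        (VU i hi hs (ballIndicator (Adic.muV (maximalRealSubfield L) (basePlaceOf L i)) 0 1))
      = VU i hi hs (dilationRep (Adic.muV (maximalRealSubfield L) (basePlaceOf L i)) (ν i) (baseTriv L i hs g)
          (ballIndicator (Adic.muV (maximalRealSubfield L) (basePlaceOf L i)) 0 1))
  -- split `v ∈ S`: the ball `D = closedBall x₀ r` and scalar `a` (CHOICE), and the INTERTWINER on `a • 1_D`
  x₀ : ∀ i : Place (maximalRealSubfield L), Fin 3 → (basePlaceOf L i).adicCompletion (maximalRealSubfield L)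
  r : Place (maximalRealSubfield L) → ℝ
  a : Place (maximalRealSubfield L) → ℂ
  hr : ∀ i ∈ S, IsSplitPlace L i → r i < ‖x₀ i‖
  hr0 : ∀ i ∈ S, IsSplitPlace L i → 0 < r i
  hνS : ∀ i ∈ S, IsSplitPlace L i → ∀ y : ((basePlaceOf L i).adicCompletion (maximalRealSubfield L))ˣ,
    (y : (basePlaceOf L i).adicCompletion (maximalRealSubfield L)) ∈ U1 (x₀ i) (r i) → ν i y = 1
  hχS : ∀ i (_ : i ∈ S) (hs : IsSplitPlace L i), ∀ g : locTorus (maximalRealSubfield L) L i,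
    ((baseTriv L i hs g : ((basePlaceOf L i).adicCompletion (maximalRealSubfield L))ˣ) :
        (basePlaceOf L i).adicCompletion (maximalRealSubfield L)) ∈ U1 (x₀ i) (r i) →
      χ (RestrictedProduct.mulSingle (genLevel L) i g) = 1
  VS : ∀ i, i ∈ S → IsSplitPlace L i →
    (Lp ℂ 2 (Adic.muV (maximalRealSubfield L) (basePlaceOf L i)) →ₗᵢ[ℂ] Sp)
  hVSψ : ∀ i (hi : i ∈ S) (hs : IsSplitPlace L i),
    VS i hi hs (a i • ballIndicator (Adic.muV (maximalRealSubfield L) (basePlaceOf L i)) (x₀ i) (r i)) = φ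
  hVS : ∀ i (hi : i ∈ S) (hs : IsSplitPlace L i), ∀ g : locTorus (maximalRealSubfield L) L i,
    ω (RestrictedProduct.mulSingle (genLevel L) i g)
        (VS i hi hs (a i • ballIndicator (Adic.muV (maximalRealSubfield L) (basePlaceOf L i)) (x₀ i) (r i)))
      = VS i hi hs (dilationRep (Adic.muV (maximalRealSubfield L) (basePlaceOf L i)) (ν i) (baseTriv L i hs g)
          (a i • ballIndicator (Adic.muV (maximalRealSubfield L) (basePlaceOf L i)) (x₀ i) (r i)))
  -- non-split `v ∈ S` (every infinite place included): isotypy of `φ`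
  hiso : ∀ i ∈ S, ¬IsSplitPlace L i → ∀ g : locTorus (maximalRealSubfield L) L i, ω (RestrictedProduct.mulSingle (genLevel L) i g) φ
    = conj (((χ (RestrictedProduct.mulSingle (genLevel L) i g) : Circle) : ℂ)) • φ

/-! ## §2  The headline from the input -/

section ofInput

variable (L : Type) [Field L] [NumberField L] [IsCMField L]

variable [DecidableEq (Place (maximalRealSubfield L))]
  [∀ v : HeightOneSpectrum (𝓞 (maximalRealSubfield L)), MeasurableSpace (v.adicCompletion (maximalRealSubfield L))]
  [∀ v : HeightOneSpectrum (𝓞 (maximalRealSubfield L)), BorelSpace (v.adicCompletion (maximalRealSubfield L))]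
  (S₀ : Finset (Place (maximalRealSubfield L)))
  {Sp : Type} [NormedAddCommGroup Sp] [InnerProductSpace ℂ Sp]
  {W : Type} [AddCommGroup W] [Module L W]
  {H Sbox : Type} [Group H] [AddCommGroup Sbox] [Module ℂ Sbox]
  {h : W →ₗ⋆[L] W →ₗ[L] L} (hW : IsLine L W) (hh : Anisotropic h)
  (D : DoublingDatum (Model L) H Sp Sbox) (GU : ThetaSide Sp Sbox)
  (j : isomBox h →* H) (hj : ∀ d : unitary L, j ⟨iotaSnd d, iotaSnd_mem h d⟩ = D.ι (1, unitaryToModel L d))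
  (χ : Model L →* Circle) (hχΓ : ∀ d : unitary L, χ (unitaryToModel L d) = 1)
  (hχVΓ : ∀ d : unitary L, D.χV (unitaryToModel L d) = 1)
  {hP : ∀ Ψ : Sbox, ∀ p ∈ (stabDelta L W).subgroupOf (isomBox h), ∀ x : H,
    D.fSW Ψ (j p * x) = D.fSW Ψ x}
  (P : GluePrintInputs D GU h j hP) (φ : Sp)
  (hφ : ‖φ‖ = 1)
  (hloc : ∀ (i : Place (maximalRealSubfield L)) (v : Sp),
    Continuous fun g : locTorus (maximalRealSubfield L) L i => D.ω (RestrictedProduct.mulSingle (genLevel L) i g) v)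
  {T' : Finset (Place (maximalRealSubfield L))} (hχT' : RestrictedProduct.boxSubgroup (genLevel L) T' ≤ χ.ker)
  (hlocχ : ∀ i ∈ T', Continuous fun g : locTorus (maximalRealSubfield L) L i => χ (RestrictedProduct.mulSingle (genLevel L) i g))
  {T : Finset (Place (maximalRealSubfield L))} (hK : ∀ k ∈ RestrictedProduct.boxSubgroup (genLevel L) T, D.ω k φ = φ)
  (hM : ∀ S : Finset (Place (maximalRealSubfield L)), T ⊆ S → ∀ y : (i : ↥S) → locTorus (maximalRealSubfield L) L i,
    inner ℂ φ (D.ω (extendOne (genLevel L) S y) φ) = ∏ i : ↥S, localCoeff (genLevel L) D.ω φ i (y i))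
  {S : Finset (Place (maximalRealSubfield L))} (hTS : T ⊆ S) (hT'S : T' ⊆ S)
  -- bookkeeping: `S` contains the infinite places
  (hS : ∀ v : InfinitePlace (maximalRealSubfield L), Sum.inl v ∈ S)

include hW hh hj hχΓ hχVΓ P hφ hloc hK hM hTS hT'S hS

set_option synthInstance.maxHeartbeats 200000 in
-- (as in #1–#3: the `SMul Γ (Model L)` instance behind `IsFundamentalDomain` is slow to find at these concrete types)
/-- **S3 HEADLINE for `U(1)_{L/L⁺}(𝔸_{L⁺}) ⊇ U(1)(L⁺)` from ONE named input** (`GenuineThetaInput`): #3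
`exists_compactDomain_thetaLift_ne_zero_genuine_base` with its sixteen representation-side binders read off `X`. -/
theorem exists_compactDomain_thetaLift_ne_zero_genuine_of_input [IsFiniteMeasure GU.μ]
    (X : GenuineThetaInput L S Sp D.ω φ χ) :
    ∃ 𝓕 : Set (Model L), IsCompact 𝓕 ∧ (interior 𝓕).Nonempty ∧ MeasurableSet 𝓕 ∧
      IsFundamentalDomain (unitaryToModel L).range 𝓕 (haarDatum (genLevel L) (isCompact_genLevel L) (isOpen_genLevel L) S₀).μ ∧
      (haarDatum (genLevel L) (isCompact_genLevel L) (isOpen_genLevel L) S₀).μ 𝓕 ≠ 0 ∧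
      (haarDatum (genLevel L) (isCompact_genLevel L) (isOpen_genLevel L) S₀).μ 𝓕 ≠ ⊤ ∧
      ∀ [IsFiniteMeasure (((haarDatum (genLevel L) (isCompact_genLevel L) (isOpen_genLevel L) S₀).μ).restrict 𝓕)]
        (hk : Measurable (Function.uncurry (thetaFn D GU φ))) {Ck : ℝ} (hCk : 0 ≤ Ck)
        (hkC : ∀ q u, ‖thetaFn D GU φ q u‖ ≤ Ck),
        PeterssonFubini.theta GU.μ (((haarDatum (genLevel L) (isCompact_genLevel L) (isOpen_genLevel L) S₀).μ).restrict 𝓕) hk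
          (measurable_coe_char (genLevel L) (isOpen_genLevel L) χ hχT' hlocχ) hCk hkC (norm_coe_char_le χ) ≠ 0 :=
  exists_compactDomain_thetaLift_ne_zero_genuine_base L S₀ hW hh D GU j hj χ hχΓ hχVΓ P φ hφ hloc hχT' hlocχ hK hM
    hTS hT'S hS X.ν X.hν X.VU X.hVUψ X.hVU X.x₀ X.r X.a X.hr X.hr0 X.hνS X.hχS X.VS X.hVSψ X.hVS X.hiso

end ofInput

end HodgeCM.PerL34.PureTensor

end
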